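import Mathlib.LinearAlgebra.Matrix.SchurComplement
import Literature.LinearAlgebra.QuadraticForm.MaslovIndexTransverse
import Summits.Ventures.HSemireg.WedgeHankelRecurrenceSignature

/-!
# Venture HSemireg — JACOBI'S RULE: for a symmetric matrix over a LINEARLY ORDERED field whose leading principal minors `D_1, …, D_N` are all non-zero (`D_0 = 1`),
# **`sigPos = #{k < N | D_k D_{k+1} > 0}` (sign PERMANENCES) and `sigNeg = #{k < N | D_k D_{k+1} < 0}` (sign VARIATIONS) in `D_0, D_1, …, D_N`**; the bordering step behind it
# (**`sigPos (A B; Bᵀ D) = sigPos A + sigPos (D − BᵀA⁻¹B)`**, Haynsworth's inertia additivity, any symmetric invertible corner `A`); and for the lineage's Hankel forms the HERMITE–JACOBI ROOT COUNT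
# **`#{λ ∈ roots m | a(λ) ≷ 0} = #{k ≤ t | Δ_{k−1}Δ_k ≷ 0}`**, `Δ_k = det H_k(a·m′/m)` (`m` split, all `Δ_k ≠ 0`) — the signature of Hermite's form read off its leading minors, no diagonalisation

HONEST FRAMING. Part of the Lean index of the computation cell `pub-hsemireg` (seat p10 gen 34, Sunday typer «UNIFORM-IN-n»).
LINEAR ALGEBRA OF QUADRATIC FORMS AND (block, Hankel) MATRICES over a field ONLY (Mathlib's `sigPos` ∕ `sigNeg`, `Matrix.fromBlocks`, `Matrix.schur_complement_eq₁₁`, `Matrix.det_fromBlocks₁₁`,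
`QuadraticMap.prod`): no variety, no cohomology theory, no sheaf, no Ext group and no semiregularity map is constructed here; nothing here says that HC / HC_CM / HC_AV holds; no Literature fact is
declared or used (PROVED Literature `LinearAlgebra/QuadraticForm/MaslovIndexTransverse.sigPos_prod` ∕ `sigNeg_prod` and `QuadraticFormDeterminantCharTwo.toQuadraticForm'_apply` are IMPORTED and used).
Custodian versions as in `WedgeHankelSiegelIdeal` (1/3).
SOURCE OF THE ARGUMENT (classical, cited not used): C. G. J. Jacobi, *Über eine elementare Transformation eines in Bezug auf jedes von zwei Variablen-Systemen linearen und homogenen Ausdrucks*,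
J. reine angew. Math. 53 (1857) 265–270; F. R. Gantmacher, *The Theory of Matrices* I, Ch. X §3 (Jacobi's theorem: for `D_1 ⋯ D_r ≠ 0` the form is `Σ_k (D_k/D_{k−1}) X_k²`, so `π = P(1, D_1, …, D_r)`,
`ν = V(1, D_1, …, D_r)`) and II, Ch. XV §11 (applied to Hankel forms); E. V. Haynsworth, *Determination of the inertia of a partitioned Hermitian matrix*, Linear Algebra Appl. 1 (1968) 73–81
(`In(M) = In(A) + In(M/A)`); S. Basu, R. Pollack, M.-F. Roy, *Algorithms in Real Algebraic Geometry* (2nd ed. 2006) §4.3 Rem. 4.59 ∕ §9.1 (signature of Hankel forms from principal minors ∕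
signed subresultants).  The one computation used is Mathlib's completion of the square `Matrix.schur_complement_eq₁₁` (stated there for `StarRing`s; read here with the trivial involution).
DEDUP DISCLOSURE (`rg` of the whole tree + Mathlib, 2026-09-01): Mathlib has Schur complements for `det` ∕ `PosDef` (`det_fromBlocks₁₁`, `PosDef.fromBlocks₁₁`, `IsHermitian.fromBlocks₁₁`) but no inertia
additivity and no Jacobi COUNT of `sigPos` ∕ `sigNeg`; PROVED Literature `LinearAlgebra/Matrix/SylvesterCriterion.lean` (Horn–Johnson Thm. 7.2.5: `posDef_iff_leadingMinors_pos`, `Matrix.PosDef` over `RCLike`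
fields ⟺ all leading minors `> 0`) is the DEFINITE case `V = 0` in `Matrix.PosDef` language — `sigPos_eq_of_det_pos` below is its inertia-count shadow over any linearly ordered field (disclosed; different
statement and type, not restated); `LUFactorization` (Horn–Johnson §3.5, LU ⟺ leading minors non-singular) has no signature,
`HyperbolicTypeSignature` ∕ `HermitianCongruenceInertia` ∕ `MiddleMatrixSignature` compute other signatures; the ONLY inertia-additivity statement in the tree is the QuantumFields∕QCD summit's
`negRootCount_fromBlocks_haynsworth` (Hermitian matrices over `ℂ`, inertia as an EIGENVALUE count `negRootCount`, pivot `D`) — a different formalism (here: any linearly ordered field, Mathlib's `sigPos` ∕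
`sigNeg` of the quadratic form, pivot `A`, plus the Jacobi count, which is nowhere in the tree); disclosed, not imported (summit-foreign).  The 18 names below: 0 hits tree-wide.

WHAT IS IN THE TREE.  N46: `hankelSq K t q = Matrix.of (i j ↦ q_{i+j})` on `Fin (t+1)`.  N126 (`WedgeHankelRecurrenceInertia`): **`sigPos_comp_eq_of_surjective`** ∕ `sigNeg_comp_eq_of_surjective`, `sigPos_le_finrank` (Mathlib).
N127 (`WedgeHankelRecurrenceSignature`): `sigPos/sigNeg_hankelSq_dualSeq_mul_derivative` (Hermite–Sylvester, split `m`).  Mathlib: `Matrix.schur_complement_eq₁₁`, `Matrix.det_fromBlocks₁₁`, `Matrix.invertibleOfIsUnitDet`,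
`Matrix.det_unique`, `Matrix.det_fin_zero`, `Matrix.det_submatrix_equiv_self`, `finSumFinEquiv` (+ `_apply_left/right`, `Fin.val_castAdd/natAdd`), `LinearMap.funLeft`, `LinearEquiv.funCongrLeft`, `QuadraticForm.sigPos/sigNeg_weightedSumSquares`,
`starRingOfComm` (the trivial `StarRing` structure, used INSIDE one proof via `letI`, no instance declared), `Finset.range_add_one` ∕ `Finset.filter_insert`.
THIS FILE (namespace `Summit.Ventures.HSemireg.Wedge.HankelOuter` continued; PLAIN on N127 (hence N126) + PROVED Literature `MaslovIndexTransverse`; 0 definitions — leading blocks of a table `S : ℕ → ℕ → K` are written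
`Matrix.of (fun i j : Fin k => S i j)` so that all sizes live in one family without `Fin` casts, `D_k := det` of that, `D_0 = det` of the empty matrix `= 1`):
* §728 ONE BORDERING STEP (`A : Matrix m m K` symmetric, `IsUnit A.det`, `B : Matrix m n K`, `D : Matrix n n K`): `dotProduct_fromBlocks_mulVec` (completion of the square), **`toQuadraticForm'_fromBlocks_eq_prod_comp`**
  (`(A B; Bᵀ D)` = pull-back of `A ⊥ (D − BᵀA⁻¹B)` along `(x;y) ↦ (x + A⁻¹By, y)`), `funLeft_add_mulVecLin_prod_surjective`, **`sigPos_toQuadraticForm'_fromBlocks`** ∕ **`sigNeg_toQuadraticForm'_fromBlocks`** (HAYNSWORTH: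
  inertia of the block = inertia of the corner + inertia of the Schur complement), `sigPos_sigNeg_toQuadraticForm'_unique` (`1 × 1`: `([s > 0], [s < 0])`), `det_fromBlocks_unique` (`det = det A · s`).
* §729 TABLES: `submatrix_of_succ_finSumFinEquiv` (the `(k+1)`-st leading block re-indexed along `Fin k ⊕ Fin 1 ≃ Fin (k+1)` IS the bordered `k`-th block), `toQuadraticForm'_submatrix_equiv`,
  `sigPos_sigNeg_toQuadraticForm'_submatrix_equiv` (re-indexing preserves inertia).
* §730 JACOBI: `sigPos_sigNeg_eq_zero_of_isEmpty`, **`sigPos_sigNeg_eq_card_filter_det_mul_det`** (THE RULE, by induction on `N`), **`sigPos_sub_sigNeg_eq_sum_sign_det_mul_det`** (`Sign = Σ_k sign(D_k D_{k+1}) = P − V`),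
  **`sigPos_eq_of_det_pos`** (all `D_k > 0` ⇒ inertia `(N, 0)`: Sylvester's criterion as a count).
* §731 HANKEL: `hankelSq_eq_of`, **`sigPos_sigNeg_hankelSq_eq_card_filter`** (Jacobi for `H_t(q)` with `Δ_k = det H_k(q)`, `k ≤ t`, all `≠ 0`), `sigPos_sigNeg_hankelSq_of_det_pos`,
  **`card_roots_filter_eq_card_filter_det`** (HERMITE–JACOBI: for split monic `m`, `deg m ≤ t + 1`, `#{a(λ) > 0} ∕ #{a(λ) < 0}` on the distinct roots = permanences ∕ variations of `1, Δ_0, …, Δ_t`, `Δ_k = det H_k(a m′/m)`).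
CAVEATS.  The rule needs ALL `D_1, …, D_N ≠ 0` (the classical extensions of Gundelfinger ∕ Frobenius for isolated zeros are NOT typed); `A` is the pivot (upper-left corner), i.e. Haynsworth with `M/A`;
the Hankel root count needs `m` split over `K` (N127) — over `ℝ` with non-real roots use N128 instead of N127 on the left (not restated here); `K` any linearly ordered field (no real closure needed for
§728–§731 themselves).
Nothing Ext-side.  New names only.
-/

open Module Polynomial
open scoped Matrix Polynomial

namespace Summit.Ventures.HSemireg.Wedge.HankelOuter

open Summit.Ventures.HSemireg.Wedge Summit.Ventures.HSemireg.Wedge.Hankel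

/-! ## §728. One bordering step: the form of `(A B; Bᵀ D)` with `A` symmetric invertible is `A ⊥ (D − BᵀA⁻¹B)` pulled back along a unipotent change of variables -/

section Schur

variable {K : Type*} [Field K] {m n : Type*} [Fintype m] [Fintype n] [DecidableEq m]

/-- **Completion of the square (Schur): `(x;y)ᵀ (A B; Bᵀ D) (x;y) = (x + A⁻¹By)ᵀ A (x + A⁻¹By) + yᵀ (D − BᵀA⁻¹B) y`** for `A` symmetric with `det A ≠ 0` (Mathlib's `Matrix.schur_complement_eq₁₁`, read with the
trivial involution). [this file, §728] -/
theorem dotProduct_fromBlocks_mulVec {A : Matrix m m K} (hA : A.IsSymm) (hAu : IsUnit A.det) (B : Matrix m n K) (D : Matrix n n K) (x : m → K) (y : n → K) :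
    Sum.elim x y ⬝ᵥ (Matrix.fromBlocks A B Bᵀ D *ᵥ Sum.elim x y)
      = (x + (A⁻¹ * B) *ᵥ y) ⬝ᵥ (A *ᵥ (x + (A⁻¹ * B) *ᵥ y)) + y ⬝ᵥ ((D - Bᵀ * A⁻¹ * B) *ᵥ y) := by
  letI : StarRing K := starRingOfComm
  haveI : TrivialStar K := ⟨fun _ => rfl⟩
  haveI : Invertible A := Matrix.invertibleOfIsUnitDet A hAu
  have hH : A.IsHermitian := by
    show Aᴴ = A
    rw [Matrix.conjTranspose, hA.eq]; exact Matrix.map_id _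
  have h := Matrix.schur_complement_eq₁₁ B D x y hH
  simp only [star_trivial, Matrix.conjTranspose_eq_transpose_of_trivial] at h
  rw [Matrix.dotProduct_mulVec, Matrix.dotProduct_mulVec, Matrix.dotProduct_mulVec]
  exact h

variable [DecidableEq n]

/-- **The bordered form is the pull-back of the ORTHOGONAL SUM `A ⊥ (D − BᵀA⁻¹B)` along `(x; y) ↦ (x + A⁻¹By, y)`.** [this file, §728] -/
theorem toQuadraticForm'_fromBlocks_eq_prod_comp {A : Matrix m m K} (hA : A.IsSymm) (hAu : IsUnit A.det) (B : Matrix m n K) (D : Matrix n n K) :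
    (Matrix.fromBlocks A B Bᵀ D).toQuadraticForm'
      = (A.toQuadraticForm'.prod (D - Bᵀ * A⁻¹ * B).toQuadraticForm').comp
          ((LinearMap.funLeft K K Sum.inl + (A⁻¹ * B).mulVecLin ∘ₗ LinearMap.funLeft K K Sum.inr).prod (LinearMap.funLeft K K (Sum.inr : n → m ⊕ n))) := by
  ext v
  rw [QuadraticMap.comp_apply]
  simp only [LinearMap.prod_apply, Function.prod_apply, QuadraticMap.prod_apply, LinearMap.add_apply, LinearMap.comp_apply, Matrix.mulVecLin_apply]
  rw [Literature.LinearAlgebra.QuadraticForm.DeterminantCharTwo.toQuadraticForm'_apply, Literature.LinearAlgebra.QuadraticForm.DeterminantCharTwo.toQuadraticForm'_apply,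
    Literature.LinearAlgebra.QuadraticForm.DeterminantCharTwo.toQuadraticForm'_apply]
  conv_lhs => rw [← Sum.elim_comp_inl_inr v]
  exact dotProduct_fromBlocks_mulVec hA hAu B D (v ∘ Sum.inl) (v ∘ Sum.inr)

omit [Fintype m] [DecidableEq m] [DecidableEq n] in
/-- The change of variables `(x; y) ↦ (x + A⁻¹By, y)` is onto (indeed bijective: `x = x′ − A⁻¹By`). [this file, §728] -/
theorem funLeft_add_mulVecLin_prod_surjective (M : Matrix m n K) :
    Function.Surjective ((LinearMap.funLeft K K Sum.inl + M.mulVecLin ∘ₗ LinearMap.funLeft K K Sum.inr).prod (LinearMap.funLeft K K (Sum.inr : n → m ⊕ n))) := by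
  rintro ⟨x, y⟩
  refine ⟨Sum.elim (x - M *ᵥ y) y, ?_⟩
  simp only [LinearMap.prod_apply, Function.prod_apply, LinearMap.add_apply, LinearMap.comp_apply, Matrix.mulVecLin_apply]
  change ((Sum.elim (x - M *ᵥ y) y ∘ Sum.inl) + M *ᵥ (Sum.elim (x - M *ᵥ y) y ∘ Sum.inr), Sum.elim (x - M *ᵥ y) y ∘ Sum.inr) = (x, y)
  rw [Sum.elim_comp_inl, Sum.elim_comp_inr, sub_add_cancel]

variable [LinearOrder K] [IsStrictOrderedRing K]

/-- **`sigPos (A B; Bᵀ D) = sigPos A + sigPos (D − BᵀA⁻¹B)`** for `A` symmetric with `det A ≠ 0` over a linearly ordered field (pull-back along an onto map, N126, of an orthogonal sum, Literature `sigPos_prod`).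
[this file, §728] -/
theorem sigPos_toQuadraticForm'_fromBlocks {A : Matrix m m K} (hA : A.IsSymm) (hAu : IsUnit A.det) (B : Matrix m n K) (D : Matrix n n K) :
    sigPos (Matrix.fromBlocks A B Bᵀ D).toQuadraticForm' = sigPos A.toQuadraticForm' + sigPos (D - Bᵀ * A⁻¹ * B).toQuadraticForm' := by
  rw [toQuadraticForm'_fromBlocks_eq_prod_comp hA hAu B D, sigPos_comp_eq_of_surjective _ (funLeft_add_mulVecLin_prod_surjective (A⁻¹ * B)), Literature.LinearAlgebra.QuadraticForm.sigPos_prod]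

/-- **`sigNeg (A B; Bᵀ D) = sigNeg A + sigNeg (D − BᵀA⁻¹B)`.** [this file, §728] -/
theorem sigNeg_toQuadraticForm'_fromBlocks {A : Matrix m m K} (hA : A.IsSymm) (hAu : IsUnit A.det) (B : Matrix m n K) (D : Matrix n n K) :
    sigNeg (Matrix.fromBlocks A B Bᵀ D).toQuadraticForm' = sigNeg A.toQuadraticForm' + sigNeg (D - Bᵀ * A⁻¹ * B).toQuadraticForm' := by
  rw [toQuadraticForm'_fromBlocks_eq_prod_comp hA hAu B D, sigNeg_comp_eq_of_surjective _ (funLeft_add_mulVecLin_prod_surjective (A⁻¹ * B)), Literature.LinearAlgebra.QuadraticForm.sigNeg_prod]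

omit [DecidableEq m] in
/-- A `1 × 1` form `s·y²` has `sigPos = [s > 0]`, `sigNeg = [s < 0]`. [this file, §728] -/
theorem sigPos_sigNeg_toQuadraticForm'_unique [Unique n] (S : Matrix n n K) :
    sigPos S.toQuadraticForm' = (if 0 < S default default then 1 else 0) ∧ sigNeg S.toQuadraticForm' = (if S default default < 0 then 1 else 0) := by
  have hS : S.toQuadraticForm' = QuadraticMap.weightedSumSquares K fun _ : n => S default default := by
    ext y
    rw [Literature.LinearAlgebra.QuadraticForm.DeterminantCharTwo.toQuadraticForm'_apply, QuadraticMap.weightedSumSquares_apply, dotProduct, Fintype.sum_unique, Fintype.sum_unique, Matrix.mulVec, dotProduct,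
      Fintype.sum_unique, smul_eq_mul]
    ring
  rw [hS, QuadraticForm.sigPos_weightedSumSquares, QuadraticForm.sigNeg_weightedSumSquares]
  constructor
  · split_ifs with h
    · rw [show {i : n | 0 < S default default} = Set.univ from Set.eq_univ_of_forall fun _ => h, Set.ncard_univ, Nat.card_unique]
    · rw [show {i : n | 0 < S default default} = ∅ from Set.eq_empty_of_forall_notMem fun _ hi => h hi, Set.ncard_empty]
  · split_ifs with h
    · rw [show {i : n | S default default < 0} = Set.univ from Set.eq_univ_of_forall fun _ => h, Set.ncard_univ, Nat.card_unique]
    · rw [show {i : n | S default default < 0} = ∅ from Set.eq_empty_of_forall_notMem fun _ hi => h hi, Set.ncard_empty]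

omit [LinearOrder K] [IsStrictOrderedRing K] in
/-- **`det (A B; Bᵀ D) = det A · (D − BᵀA⁻¹B)`** for a one-row border (`Matrix.det_fromBlocks₁₁`). [this file, §728] -/
theorem det_fromBlocks_unique [Unique n] {A : Matrix m m K} (hAu : IsUnit A.det) (B : Matrix m n K) (C : Matrix n m K) (D : Matrix n n K) :
    (Matrix.fromBlocks A B C D).det = A.det * (D - C * A⁻¹ * B) default default := by
  haveI : Invertible A := Matrix.invertibleOfIsUnitDet A hAu
  rw [Matrix.det_fromBlocks₁₁, Matrix.invOf_eq_nonsing_inv, Matrix.det_unique (D - C * A⁻¹ * B)]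

end Schur

/-! ## §729. Symmetric tables: the `(k+1)`-st leading block is the `k`-th one bordered by one row and column -/

section Table

variable {K : Type*} [Field K]

omit [Field K] in
/-- Re-indexed along `Fin k ⊕ Fin 1 ≃ Fin (k + 1)`, the leading `(k+1) × (k+1)` block of a table `S : ℕ → ℕ → K` is the block matrix `(S[<k] b; bᵀ S_kk)` with `b_i = S i k` (for `S` symmetric the lower
border is `bᵀ`). [this file, §729] -/
theorem submatrix_of_succ_finSumFinEquiv {S : ℕ → ℕ → K} (hS : ∀ i j, S i j = S j i) (k : ℕ) :
    (Matrix.of fun i j : Fin (k + 1) => S i j).submatrix finSumFinEquiv finSumFinEquiv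
      = Matrix.fromBlocks (Matrix.of fun i j : Fin k => S i j) (Matrix.of fun (i : Fin k) (_ : Fin 1) => S i k) (Matrix.of fun (i : Fin k) (_ : Fin 1) => S i k)ᵀ (Matrix.of fun _ _ : Fin 1 => S k k) := by
  ext (i | i) (j | j)
  · rw [Matrix.submatrix_apply, Matrix.fromBlocks_apply₁₁, finSumFinEquiv_apply_left, finSumFinEquiv_apply_left, Matrix.of_apply, Matrix.of_apply, Fin.val_castAdd, Fin.val_castAdd]
  · rw [Matrix.submatrix_apply, Matrix.fromBlocks_apply₁₂, finSumFinEquiv_apply_left, finSumFinEquiv_apply_right, Matrix.of_apply, Matrix.of_apply, Fin.val_castAdd, Fin.val_natAdd,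
      Fin.val_eq_zero j, add_zero]
  · rw [Matrix.submatrix_apply, Matrix.fromBlocks_apply₂₁, finSumFinEquiv_apply_right, finSumFinEquiv_apply_left, Matrix.of_apply, Matrix.transpose_apply, Matrix.of_apply, Fin.val_castAdd,
      Fin.val_natAdd, Fin.val_eq_zero i, add_zero, hS]
  · rw [Matrix.submatrix_apply, Matrix.fromBlocks_apply₂₂, finSumFinEquiv_apply_right, finSumFinEquiv_apply_right, Matrix.of_apply, Matrix.of_apply, Fin.val_natAdd, Fin.val_natAdd,
      Fin.val_eq_zero i, Fin.val_eq_zero j, add_zero]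

variable {m n : Type*} [Fintype m] [Fintype n] [DecidableEq m] [DecidableEq n]

/-- Re-indexing a matrix along an equivalence pulls its quadratic form back along the induced linear equivalence: `wᵀ (M∘e) w = (w ∘ e⁻¹)ᵀ M (w ∘ e⁻¹)`. [this file, §729] -/
theorem toQuadraticForm'_submatrix_equiv (M : Matrix n n K) (e : m ≃ n) (w : m → K) :
    (M.submatrix e e).toQuadraticForm' w = M.toQuadraticForm' (w ∘ e.symm) := by
  rw [Literature.LinearAlgebra.QuadraticForm.DeterminantCharTwo.toQuadraticForm'_apply, Literature.LinearAlgebra.QuadraticForm.DeterminantCharTwo.toQuadraticForm'_apply, dotProduct, dotProduct,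
    ← e.sum_comp]
  refine Finset.sum_congr rfl fun a _ => ?_
  rw [Function.comp_apply, e.symm_apply_apply, Matrix.mulVec, Matrix.mulVec, dotProduct, dotProduct, ← e.sum_comp]
  refine congrArg _ (Finset.sum_congr rfl fun b _ => ?_)
  rw [Matrix.submatrix_apply, Function.comp_apply, e.symm_apply_apply]

/-- Hence `M∘e` and `M` have the same inertia (any equivalence `e`; linearly ordered field). [this file, §729] -/
theorem sigPos_sigNeg_toQuadraticForm'_submatrix_equiv [LinearOrder K] (M : Matrix n n K) (e : m ≃ n) :
    sigPos (M.submatrix e e).toQuadraticForm' = sigPos M.toQuadraticForm' ∧ sigNeg (M.submatrix e e).toQuadraticForm' = sigNeg M.toQuadraticForm' := by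
  have h : (M.submatrix e e).toQuadraticForm' = M.toQuadraticForm'.comp (LinearEquiv.funCongrLeft K K e.symm).toLinearMap := by
    ext w
    rw [toQuadraticForm'_submatrix_equiv, QuadraticMap.comp_apply]
    rfl
  rw [h]
  exact ⟨sigPos_comp_eq_of_surjective _ (LinearEquiv.funCongrLeft K K e.symm).surjective, sigNeg_comp_eq_of_surjective _ (LinearEquiv.funCongrLeft K K e.symm).surjective⟩

end Table

/-! ## §730. JACOBI'S RULE: the inertia of a symmetric matrix with non-vanishing leading principal minors `D_1, …, D_N` is read off the signs of `D_{k} D_{k+1}` (`D_0 = 1`) -/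

section Jacobi

variable {K : Type*} [Field K] [LinearOrder K] [IsStrictOrderedRing K]

omit [IsStrictOrderedRing K] in
/-- A quadratic form on `K^0` has both indices `0`. [bookkeeping] -/
theorem sigPos_sigNeg_eq_zero_of_isEmpty {ι : Type*} [Fintype ι] [IsEmpty ι] (Q : QuadraticForm K (ι → K)) : sigPos Q = 0 ∧ sigNeg Q = 0 := by
  have h0 : Module.finrank K (ι → K) = 0 := by rw [Module.finrank_fintype_fun_eq_card, Fintype.card_eq_zero]
  exact ⟨Nat.eq_zero_of_le_zero (h0 ▸ sigPos_le_finrank Q), Nat.eq_zero_of_le_zero (h0 ▸ sigPos_le_finrank (-Q))⟩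

/-- **JACOBI'S RULE (C. G. J. Jacobi 1857; Gantmacher I, Ch. X §3; for Hankel forms BPR Rem. 4.59 ∕ §9.1).** Let `S : ℕ → ℕ → K` be a symmetric table over a linearly ordered field and `D_k = det (S_{ij})_{i,j<k}` its
leading principal minors (`D_0 = 1`). If `D_1, …, D_N ≠ 0` then the quadratic form of the `N × N` block has **`sigPos = #{k < N | D_k D_{k+1} > 0}` (sign permanences) and `sigNeg = #{k < N | D_k D_{k+1} < 0}`
(sign variations) in the sequence `1 = D_0, D_1, …, D_N`** — by induction: bordering the `k`-th block adds the square `(D_{k+1}/D_k)·y²` (§728–§729). [this file, §730] -/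
theorem sigPos_sigNeg_eq_card_filter_det_mul_det {S : ℕ → ℕ → K} (hS : ∀ i j, S i j = S j i) (N : ℕ) (hD : ∀ k, k ≤ N → (Matrix.of fun i j : Fin k => S i j).det ≠ 0) :
    sigPos (Matrix.of fun i j : Fin N => S i j).toQuadraticForm' = ((Finset.range N).filter fun k => 0 < (Matrix.of fun i j : Fin k => S i j).det * (Matrix.of fun i j : Fin (k + 1) => S i j).det).card
      ∧ sigNeg (Matrix.of fun i j : Fin N => S i j).toQuadraticForm' = ((Finset.range N).filter fun k => (Matrix.of fun i j : Fin k => S i j).det * (Matrix.of fun i j : Fin (k + 1) => S i j).det < 0).card := by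
  induction N with
  | zero =>
    rw [Finset.range_zero, Finset.filter_empty, Finset.filter_empty, Finset.card_empty]
    exact sigPos_sigNeg_eq_zero_of_isEmpty _
  | succ k ih =>
    obtain ⟨ihp, ihn⟩ := ih fun j hj => hD j (Nat.le_succ_of_le hj)
    -- the blocks
    set A : Matrix (Fin k) (Fin k) K := Matrix.of fun i j : Fin k => S i j with hAdef
    set B : Matrix (Fin k) (Fin 1) K := Matrix.of fun (i : Fin k) (_ : Fin 1) => S i k with hBdef
    set D : Matrix (Fin 1) (Fin 1) K := Matrix.of fun _ _ : Fin 1 => S k k with hDdef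
    have hA : A.IsSymm := by ext i j; exact hS j i
    have hAu : IsUnit A.det := isUnit_iff_ne_zero.2 (hD k (Nat.le_succ k))
    have hblock := submatrix_of_succ_finSumFinEquiv hS k
    -- inertia and determinant through the block decomposition
    obtain ⟨hp, hn⟩ := sigPos_sigNeg_toQuadraticForm'_submatrix_equiv (Matrix.of fun i j : Fin (k + 1) => S i j) finSumFinEquiv
    rw [hblock] at hp hn
    have hdet : (Matrix.of fun i j : Fin (k + 1) => S i j).det = A.det * (D - Bᵀ * A⁻¹ * B) default default := by
      rw [← Matrix.det_submatrix_equiv_self finSumFinEquiv, hblock, det_fromBlocks_unique hAu]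
    obtain ⟨h1p, h1n⟩ := sigPos_sigNeg_toQuadraticForm'_unique (D - Bᵀ * A⁻¹ * B)
    -- the sign of the Schur scalar `s = D_{k+1}/D_k` is the sign of `D_k · D_{k+1} = D_k² s`
    set s : K := (D - Bᵀ * A⁻¹ * B) default default with hsdef
    have h2 : 0 < A.det * A.det := mul_self_pos.2 hAu.ne_zero
    have hpos : 0 < A.det * (A.det * s) ↔ 0 < s := by rw [← mul_assoc]; exact mul_pos_iff_of_pos_left h2
    have hneg : A.det * (A.det * s) < 0 ↔ s < 0 := by rw [← mul_assoc, mul_neg_iff, and_iff_right h2, or_iff_left fun h => (not_lt.2 h2.le) h.1]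
    rw [Finset.range_add_one, Finset.filter_insert, Finset.filter_insert, hdet]
    refine ⟨?_, ?_⟩
    · rw [← hp, sigPos_toQuadraticForm'_fromBlocks hA hAu, ihp, h1p]
      by_cases h : 0 < s
      · rw [if_pos h, if_pos (hpos.2 h), Finset.card_insert_of_notMem (by simp)]
      · rw [if_neg h, if_neg fun h' => h (hpos.1 h'), add_zero]
    · rw [← hn, sigNeg_toQuadraticForm'_fromBlocks hA hAu, ihn, h1n]
      by_cases h : s < 0
      · rw [if_pos h, if_pos (hneg.2 h), Finset.card_insert_of_notMem (by simp)]
      · rw [if_neg h, if_neg fun h' => h (hneg.1 h'), add_zero]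

/-- **`sigPos − sigNeg = Σ_{k<N} sign(D_k D_{k+1})` = (permanences) − (variations) of sign in `D_0, …, D_N`** (same hypotheses). [this file, §730] -/
theorem sigPos_sub_sigNeg_eq_sum_sign_det_mul_det {S : ℕ → ℕ → K} (hS : ∀ i j, S i j = S j i) (N : ℕ) (hD : ∀ k, k ≤ N → (Matrix.of fun i j : Fin k => S i j).det ≠ 0) :
    (sigPos (Matrix.of fun i j : Fin N => S i j).toQuadraticForm' : ℤ) - sigNeg (Matrix.of fun i j : Fin N => S i j).toQuadraticForm'
      = ∑ k ∈ Finset.range N, (SignType.sign ((Matrix.of fun i j : Fin k => S i j).det * (Matrix.of fun i j : Fin (k + 1) => S i j).det) : ℤ) := by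
  obtain ⟨hp, hn⟩ := sigPos_sigNeg_eq_card_filter_det_mul_det hS N hD
  rw [hp, hn, Finset.card_filter, Finset.card_filter, Nat.cast_sum, Nat.cast_sum, ← Finset.sum_sub_distrib]
  refine Finset.sum_congr rfl fun k hk => ?_
  have hne : (Matrix.of fun i j : Fin k => S i j).det * (Matrix.of fun i j : Fin (k + 1) => S i j).det ≠ 0 :=
    mul_ne_zero (hD k (Finset.mem_range.1 hk).le) (hD (k + 1) (Finset.mem_range.1 hk))
  rcases hne.lt_or_gt with h | h
  · rw [if_neg (not_lt.2 h.le), if_pos h, sign_neg h]; simp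
  · rw [if_pos h, if_neg (not_lt.2 h.le), sign_pos h]; simp

/-- **All leading minors POSITIVE ⇒ inertia `(N, 0)`** (the definite case of Jacobi's rule = Sylvester's criterion read as a count; the `Matrix.PosDef` equivalence over `RCLike` fields is PROVED Literature
`SylvesterCriterion.posDef_iff_leadingMinors_pos`, not used here). [this file, §730] -/
theorem sigPos_eq_of_det_pos {S : ℕ → ℕ → K} (hS : ∀ i j, S i j = S j i) (N : ℕ) (hD : ∀ k, k ≤ N → 0 < (Matrix.of fun i j : Fin k => S i j).det) :
    sigPos (Matrix.of fun i j : Fin N => S i j).toQuadraticForm' = N ∧ sigNeg (Matrix.of fun i j : Fin N => S i j).toQuadraticForm' = 0 := by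
  obtain ⟨hp, hn⟩ := sigPos_sigNeg_eq_card_filter_det_mul_det hS N fun k hk => (hD k hk).ne'
  rw [hp, hn, Finset.filter_true_of_mem fun k hk => mul_pos (hD k (Finset.mem_range.1 hk).le) (hD (k + 1) (Finset.mem_range.1 hk)), Finset.card_range,
    Finset.filter_false_of_mem fun k hk => not_lt.2 (mul_pos (hD k (Finset.mem_range.1 hk).le) (hD (k + 1) (Finset.mem_range.1 hk))).le, Finset.card_empty]
  exact ⟨rfl, rfl⟩

end Jacobi

/-! ## §731. Hankel matrices: Jacobi's rule for `H_t(q)` and the Hermite–Jacobi root count -/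

section Hankel

variable (K : Type*) [Field K]

omit [Field K] in
/-- The `k × k` Hankel window as a leading block of the table `(i, j) ↦ q_{i+j}`; for `k = t + 1` it is N46's `hankelSq K t q`. [bookkeeping] -/
theorem hankelSq_eq_of (t : ℕ) (q : ℕ → K) : hankelSq K t q = Matrix.of fun i j : Fin (t + 1) => q ((i : ℕ) + (j : ℕ)) := rfl

variable {K} [LinearOrder K] [IsStrictOrderedRing K]

/-- **JACOBI'S RULE FOR HANKEL FORMS: if the Hankel determinants `Δ_k = det H_k(q) = det (q_{i+j})_{i,j ≤ k}`, `k = 0, …, t`, are all non-zero, then `sigPos H_t(q) = #{k ≤ t | Δ_{k−1} Δ_k > 0}` and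
`sigNeg H_t(q) = #{k ≤ t | Δ_{k−1} Δ_k < 0}` with `Δ_{−1} = 1`** (written with the `k × k` windows `(q_{i+j})_{i,j<k}`, whose determinant for `k = 0` is `1`). [this file, §731] -/
theorem sigPos_sigNeg_hankelSq_eq_card_filter (t : ℕ) (q : ℕ → K) (hD : ∀ k, k ≤ t → (hankelSq K k q).det ≠ 0) :
    sigPos (hankelSq K t q).toQuadraticForm' = ((Finset.range (t + 1)).filter fun k => 0 < (Matrix.of fun i j : Fin k => q ((i : ℕ) + (j : ℕ))).det * (hankelSq K k q).det).card
      ∧ sigNeg (hankelSq K t q).toQuadraticForm' = ((Finset.range (t + 1)).filter fun k => (Matrix.of fun i j : Fin k => q ((i : ℕ) + (j : ℕ))).det * (hankelSq K k q).det < 0).card := by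
  have hD' : ∀ k, k ≤ t + 1 → (Matrix.of fun i j : Fin k => q ((i : ℕ) + (j : ℕ))).det ≠ 0 := by
    intro k hk
    rcases k with _ | k
    · rw [Matrix.det_fin_zero]; exact one_ne_zero
    · exact hD k (Nat.succ_le_succ_iff.1 hk)
  exact sigPos_sigNeg_eq_card_filter_det_mul_det (S := fun i j => q (i + j)) (fun i j => by rw [add_comm]) (t + 1) hD'

/-- **All Hankel determinants `Δ_0, …, Δ_t > 0` ⇒ `H_t(q)` is positive definite in inertia: `(sigPos, sigNeg) = (t + 1, 0)`.** [this file, §731] -/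
theorem sigPos_sigNeg_hankelSq_of_det_pos (t : ℕ) (q : ℕ → K) (hD : ∀ k, k ≤ t → 0 < (hankelSq K k q).det) :
    sigPos (hankelSq K t q).toQuadraticForm' = t + 1 ∧ sigNeg (hankelSq K t q).toQuadraticForm' = 0 := by
  have hD' : ∀ k, k ≤ t + 1 → 0 < (Matrix.of fun i j : Fin k => q ((i : ℕ) + (j : ℕ))).det := by
    intro k hk
    rcases k with _ | k
    · rw [Matrix.det_fin_zero]; exact one_pos
    · exact hD k (Nat.succ_le_succ_iff.1 hk)
  exact sigPos_eq_of_det_pos (S := fun i j => q (i + j)) (fun i j => by rw [add_comm]) (t + 1) hD'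

variable [DecidableEq K]

/-- **HERMITE–JACOBI ROOT COUNT: for `m` monic of degree `≤ t + 1`, split over the ordered field `K`, with all Hankel determinants `Δ_k = det H_k(a·m′/m)` (`k ≤ t`) non-zero,
`#{λ ∈ roots m | a(λ) > 0} = #{k ≤ t | Δ_{k−1}Δ_k > 0}` and `#{λ ∈ roots m | a(λ) < 0} = #{k ≤ t | Δ_{k−1}Δ_k < 0}`** (N127 Hermite–Sylvester + Jacobi; for `a = 1` the number of distinct roots is
the number of sign permanences in `1, Δ_0, …, Δ_t`). [this file, §731] -/
theorem card_roots_filter_eq_card_filter_det {t : ℕ} {m : K[X]} (hm : m.Monic) (hs : m.Splits) (hmd : m.natDegree ≤ t + 1) (a : K[X])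
    (hD : ∀ k, k ≤ t → (hankelSq K k (dualSeq K m (a * derivative m))).det ≠ 0) :
    (m.roots.toFinset.filter fun c => 0 < a.eval c).card
        = ((Finset.range (t + 1)).filter fun k => 0 < (Matrix.of fun i j : Fin k => dualSeq K m (a * derivative m) ((i : ℕ) + (j : ℕ))).det * (hankelSq K k (dualSeq K m (a * derivative m))).det).card
      ∧ (m.roots.toFinset.filter fun c => a.eval c < 0).card
        = ((Finset.range (t + 1)).filter fun k => (Matrix.of fun i j : Fin k => dualSeq K m (a * derivative m) ((i : ℕ) + (j : ℕ))).det * (hankelSq K k (dualSeq K m (a * derivative m))).det < 0).card := by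
  obtain ⟨hp, hn⟩ := sigPos_sigNeg_hankelSq_eq_card_filter t (dualSeq K m (a * derivative m)) hD
  rw [← hp, ← hn, sigPos_hankelSq_dualSeq_mul_derivative hm hs hmd, sigNeg_hankelSq_dualSeq_mul_derivative hm hs hmd]
  exact ⟨rfl, rfl⟩

end Hankel

end Summit.Ventures.HSemireg.Wedge.HankelOuter
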